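import Literature.AlgebraicGeometry.Hyperkaehler.KummerTypeHodgeSimilitudes
import Literature.AlgebraicGeometry.Hyperkaehler.GeneralizedKummerType
import Literature.AlgebraicGeometry.HodgeTheory.KugaSatakeClassBetti
import Literature.AlgebraicGeometry.Surfaces.K3Surface
import Literature.AlgebraicGeometry.Surfaces.LatticePolarizedK3Fibration
import Literature.AlgebraicGeometry.HodgeTheory.HodgeConjecture
import Literature.AlgebraicGeometry.Motives.MotivatedPeriodTorsor
import Literature.AlgebraicTopology.SingularHomology.CupProductProofs
import HarnessLib

/-!
# The K3 surface associated with a projective variety of `Kumⁿ`-type: an algebraic Hodge isometry `H²_tr(S_K, ℚ) ⥲ H²_tr(K, ℚ)(2)`, the Kuga–Satake correspondence of `S_K`, and all powers of `S_K` (Floccari, Geom. Topol. 2026, Thms. 1.1–1.2; `n = 3`: Floccari, Compos. Math. 2024, Thms. 1–3) — NAMED FACT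

Layer `Literature/AlgebraicGeometry/Hyperkaehler`.  CITE record for the cross-ladder literature-typing
layer (D-0088(4), tranche LT-H4, seat `hodge-lit-oqh-2`; consumers: the `Kumⁿ ↔ K3` TRANSFER lens of the
ladder HodgeAV, rungs H2/H3, and the cell `hodge-kum4`): Floccari–Varesco's "suggestive expectation that
any variety of `Kumⁿ`-type is naturally associated with a K3 surface" (Math. Ann. 2024 §1) is, since
Floccari 2026, a THEOREM — every projective `K` of `Kumⁿ`-type, `n ≥ 2`, has a projective K3 surface
`S_K` whose rational transcendental lattice is carried onto that of `K` (Beauville–Bogomolov form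
doubled) by a Hodge isometry INDUCED BY AN ALGEBRAIC CYCLE on `S_K × K`; and for this `S_K` the
Kuga–Satake correspondence is algebraic and every power `S_Kᵏ` satisfies the Hodge statement.  Recorded
here, in existence form, on the real carriers.

## Sources (read at source; locators = files of the materialised arXiv texts)

* [Flo26] S. Floccari, *K3 surfaces associated with varieties of generalized Kummer type*, Geom. Topol.
  30 (2026) 1129–1154 (arXiv:2501.02315) [`Floccari2026`; REFEREED].  §1 [corpus:paper-arxiv-2501.02315
  p0003:L6]: "Let `K` be a variety of `Kumⁿ`-type. By the Torelli theorem there exists a unique K3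
  surface `S_K` such that there exists a Hodge isometry `H²_tr(S_K,ℤ) ⥲ H²_tr(K,ℤ)(2)` of transcendental
  lattices, where on the right-hand side the Beauville-Bogomolov form is multiplied by a factor `2`."
  (§1 L3–L4: "by a variety of `Kumⁿ`-type we shall indicate one such manifold which is projective", "For
  any `n > 1`".)  **Theorem 1.1** [p0003:L15–L18], verbatim: "There exists an algebraic cycle on `S_K × K`
  inducing a Hodge isometry `H²_tr(S_K,ℚ) ⥲ H²_tr(K,ℚ)(2)`."  (= **Theorem 5.9** [p0017:L53–L58]: "an
  isomorphism `𝔥²_tr(S_K) ⥲ 𝔥²_tr(K)` of motives, whose realization is a Hodge isometry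
  `H²_tr(S_K,ℚ) ⥲ H²_tr(K,ℚ)(2)`".)  **Theorem 1.2** [p0003:L24–L29] (= **Theorem 5.10** [p0018:L10–L15]),
  verbatim: "Let `K` be any projective variety of `Kumⁿ`-type, and let `S_K` be the K3 surface with
  transcendental lattice `H²_tr(S_K,ℤ) ⥲ H²_tr(K,ℤ)(2)`. Then: • the Kuga-Satake correspondence is
  algebraic for `S_K`; • the Hodge conjecture holds for any power of `S_K`."  Proof of 5.10 [p0018:L17–L26]:
  Thm. 5.9; "[the Kuga–Satake statement 3.3] holds for `K` by [Voi22]. By Remark 3.7, the same conclusion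
  holds for `S_K`"; the Kuga–Satake variety of `S_K` "is isogenous to a power of `KS(K)`, and, hence, to a
  power of a Weil fourfold with discriminant `1` by [Mar23, O'G21]", then [Varesco 2023].  §3.3
  [p0007:L44–L51]: statement 3.3 (`μ' : H²(S,ℚ)_prim ↪ H²(KS(S)²,ℚ)` "is induced by an algebraic cycle on
  `S × KS(S)²`") and Remark 3.4 (equivalent `H²_tr`-form) — the tree's surface predicate
  `HodgeTheory.IsKSCorrespondenceAlgebraicBetti`.
* [Flo24] S. Floccari, *Sixfolds of generalized Kummer type and K3 surfaces*, Compos. Math. 160 (2024)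
  388–410 (arXiv:2210.02948) [`Floccari2024`; REFEREED] — the case `n = 3`: Introduction **Thm. 1**
  [corpus:paper-arxiv-2210.02948 p0003:L17–L24] (`Y_K → K/G` of `K3^[3]`-type, "isometry of transcendental
  Hodge structures `H²_tr(Y_K,ℚ) ⥲ H²_tr(K,ℚ)(2)`"), **Thm. 2** [p0003:L29–L32] (the projective K3 surface
  `S_K`, "characterized by the existence of a Hodge isometry `H²_tr(S_K,ℤ) ⥲ H²_tr(Y_K,ℤ)`"), and the
  proof of the §5.1 Theorem (= Introduction **Thm. 3**) [p0017:L40–L60], verbatim: "the Hodge isometry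
  `t₂ ∘ t₁ ∘ t₀ : H²_tr(S) ⥲ H²_tr(K)(2)` is induced by an algebraic cycle on `S × K`. The Kuga-Satake
  Hodge [statement] holds for `K` by [Voi22]. By Lemma 31, [it] holds for the K3 surface `S` as well";
  **Cor. 33** [p0017:L68–L69]: "the Hodge conjecture holds for all powers of `S`" (for the K3 surfaces
  `S` with `H²_tr(S) ↪ Λ_{Kum³}(2) ⊗ ℚ`, among them the `S_K`).
* [FV24] S. Floccari, M. Varesco, Math. Ann. (2024) (arXiv:2308.04865) [`FloccariVaresco2024`], §1
  [corpus:paper-arxiv-2308.04865 p0003:L19]: the "suggestive expectation that any variety of `Kumⁿ`-type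
  is naturally associated with a K3 surface" — resolved by [Flo26].

## Rendering (tree carriers) and faithfulness

* "projective variety of `Kumⁿ`-type", `n > 1`: `2 ≤ n`, `Motives.IsSmoothProjective (2 * n) K`,
  `IsOfGeneralizedKummerType n K` (file `GeneralizedKummerType`) — as in every `Kumⁿ` record.
* "`H²_tr(K)` with the Beauville–Bogomolov form": for a Fujiki form `b` on `H²(K(ℂ); ℂ)` (`IsFujikiForm n K b`:
  the complexified Beauville–Bogomolov form up to `ℂˣ`, file `KummerTypeHodgeSimilitudes`) the NEW
  definition `transcendentalPart K b := NS(K)^{⊥_b} ⊗ ℂ ⊂ H²(K(ℂ); ℂ)` — the classes `b`-orthogonal to the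
  Néron–Severi group `Surfaces.neronSeveriGroup K` (integral classes in the `ℂ`-span of divisor classes,
  file `Surfaces/LatticePolarizedK3Fibration`, a notion stated there for any `ℂ`-scheme) — exactly the
  printed `H²_tr := NS^⊥` (for the Beauville–Bogomolov form; independent of the scalar in `b`).  The record
  quantifies over ALL Fujiki forms `b` (classically all proportional, so `transcendentalPart K b` is one
  space; if the tree had no Fujiki form for some `K` the record would say nothing about that `K` — safe side).
* "`H²_tr(S_K)`" (surface side): the tree's `Surfaces.transcendentalSubspace S = NS(S)^⊥ ⊂ H²(S(ℂ); ℂ)`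
  (cup-product orthogonal); the lemma `transcendentalPart_eq_transcendentalSubspace` below PROVES that for
  a Fujiki form `b_S` of the surface (`IsFujikiForm 1 S b_S`: `a ∪ a = (c · b_S(a,a)) · P`, i.e. `b_S` is
  the intersection form up to `ℂˣ`) the two notions coincide (polarization + graded commutativity of `∪`).
* "a Hodge isometry `H²_tr(S_K,ℚ) ⥲ H²_tr(K,ℚ)(2)` induced by an algebraic cycle on `S_K × K`": a
  `ℂ`-linear `γ : H²(S(ℂ); ℂ) → H²(K(ℂ); ℂ)` with `HodgeTheory.IsAlgebraicCorrespondence (2 * n) 2 K S γ`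
  (`γ = Γ^*` for a class in the `ℂ`-span of cycle classes on `K × S`; WEAKER than a `ℚ`-cycle, as in every
  correspondence record of this layer) which (a) maps rational classes to rational classes
  (`IsRationalClass`; the printed cycle has `ℚ`-coefficients), (b) maps classes of Hodge type `(i,j)` of the
  surface to classes of type `(i,j)` of `K` ("Hodge"), (c) restricts to a BIJECTION
  `transcendentalSubspace S → transcendentalPart K b` (`Set.BijOn`; "`⥲`" of the transcendental parts —
  complexified; with (a) this is the rational statement), and (d) is ISOMETRIC there for SOME Fujiki form
  `b_S` of the surface: `b(γ x, γ y) = b_S(x, y)` — i.e. a SIMILITUDE between the intersection form on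
  `H²_tr(S)` and the Beauville–Bogomolov form on `H²_tr(K)`; the printed MULTIPLIER `2` ("`(2)`") is NOT
  recorded (both forms are pinned only up to scalar here) — WEAKER only there, and immaterial for the
  transfer uses in print ([Flo24] Lemma 31 / [Flo26] Remark 3.7 need a similitude with any non-zero factor).
* "the Kuga-Satake correspondence is algebraic for `S_K`": `HodgeTheory.IsKSCorrespondenceAlgebraicBetti
  hS.isSmoothProjective` ([Flo26] 3.3 in the `H²_tr`-form of Rem. 3.4 on the real carriers — the predicate
  of the tree's Thm. 3.5 record and of the summit-side leaf `KSH_K3_Betti`).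
* "the Hodge conjecture holds for any power of `S_K`": `∀ k, HodgeTheory.HodgeConjectureFor (k * 2)
  (Motives.SchemeOver.pow S k)` — the spelling of `Surfaces.Floccari2026_hodgeClasses_algebraic_powers_of_K3_of_transcendental_embedding`.
* EXISTENCE form: the record says "there is a projective K3 surface `S` with (a)–(d), the Kuga–Satake
  property and the powers property"; print gives `S = S_K`, unique up to isomorphism ([Flo26] §1, Torelli)
  — uniqueness and the integral lattice statement `H²_tr(S_K,ℤ) ≅ H²_tr(K,ℤ)(2)` are NOT recorded (no
  integral Beauville–Bogomolov carrier is used here).  Grade: REFEREED (Geom. Topol. 2026; `n = 3` Compos.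
  Math. 2024).  HONEST FRAMING: typed ≠ proved; nothing here asserts the Hodge conjecture for `K`.

## Content and D-0026 accounting

Definition (real, with API): `transcendentalPart` (+ `mem_transcendentalPart_iff`, `…apply_eq_zero`,
`transcendentalPart_eq_transcendentalSubspace`).  ONE named fact (+1; a refereed published theorem cited
at the line; `lean search` for `S_K|associatedK3|transcendentalPart|Floccari2026` finds the Thm. 5.11 /
3.5 / fixed-locus records and `KummerTypeHodgeSimilitudes` ("Not here: the K3 surface `S_K` … Floccari,
Geom. Topol. 30 (2026) Thms. 1.1–1.2"), no record of Thms. 1.1–1.2): `Floccari2026_associatedK3Surface_kummerType`.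
Kernel: the projection forgetting `γ` (`exists_K3_kugaSatake_powers`), the `Kum³` spelling (= [Flo24]
Thms. 1–3 with Cor. 33 for `S_K`, by name) and the `Kum⁴` spelling.

## Not here

The `K3^[m]`-type subvariety `W_K ⊂ K` / the resolution `Y_K → K/G` and the moduli-space description
`W_K ≅ M_{S_K,H}(v)` ([Flo26] §§4–5, [Flo24] Thms. 1–2 — moduli of sheaves on K3 surfaces are not in the
tree); the isomorphism of MOTIVES `𝔥²_tr(S_K) ≅ 𝔥²_tr(K)` (Thm. 5.9; only its realization is recorded);
uniqueness of `S_K`; the multiplier `2`; [Flo26] Thm. 1.3 = 5.12 (Weil fourfolds of discriminant `1`: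
the tree's `HodgeTheory.FloccariFu2026_hodgeClasses_algebraic_powers_discOneWeilFourfold`) and Cor. 5.13;
any proof of the fact.
-/

noncomputable section

open Literature.AlgebraicTopology.SingularHomology

namespace Literature.AlgebraicGeometry.Hyperkaehler

open HodgeTheory

/-! ### The transcendental part `NS(X)^{⊥_b} ⊗ ℂ` relative to a form `b` on `H²` -/

/-- **The transcendental part of `H²(X(ℂ); ℂ)` relative to the bilinear form `b`**: the classes
`b`-orthogonal to the Néron–Severi group `NS(X)` (`Surfaces.neronSeveriGroup X`: integral classes in the
`ℂ`-span of divisor classes) — for `X` hyperkähler and `b` (a multiple of) the Beauville–Bogomolov form this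
is `H²_tr(X) ⊗ ℂ = NS(X)^⊥ ⊗ ℂ` ([Flo26] §1 "transcendental lattices"; [Flo24] §5.1 "`(H²_tr(X), q_X)`,
where `q_X` is the restriction of the Beauville-Bogomolov form").  For a surface and `b` the intersection
form up to scalar it is the tree's `Surfaces.transcendentalSubspace`
(`transcendentalPart_eq_transcendentalSubspace`). [cite: Floccari2026, §1 (transcendental lattice H²_tr(K,ℤ) with the Beauville–Bogomolov form) and §3.3 Rem. 3.4]
[cite: Floccari2024, §5.1 (the pair (H²_tr(X), q_X))] -/
def transcendentalPart (X : Motives.SchemeOver ℂ) (b : complexBetti X 2 →ₗ[ℂ] complexBetti X 2 →ₗ[ℂ] ℂ) :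
    Submodule ℂ (complexBetti X 2) :=
  ⨅ (c : complexBetti X 2) (_ : c ∈ Surfaces.neronSeveriGroup X), LinearMap.ker (b c)

variable {X : Motives.SchemeOver ℂ} {b : complexBetti X 2 →ₗ[ℂ] complexBetti X 2 →ₗ[ℂ] ℂ}

/-- Membership in `NS(X)^{⊥_b} ⊗ ℂ`: `b`-orthogonality to every Néron–Severi class. [cite: Floccari2026, §1 and Rem. 3.4] -/
theorem mem_transcendentalPart_iff (x : complexBetti X 2) :
    x ∈ transcendentalPart X b ↔ ∀ c ∈ Surfaces.neronSeveriGroup X, b c x = 0 := by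
  simp [transcendentalPart, Submodule.mem_iInf]

/-- A transcendental class pairs to zero with every Néron–Severi class. [cite: Floccari2026, §1 and Rem. 3.4] -/
theorem transcendentalPart.apply_eq_zero {x : complexBetti X 2} (hx : x ∈ transcendentalPart X b)
    {c : complexBetti X 2} (hc : c ∈ Surfaces.neronSeveriGroup X) : b c x = 0 :=
  (mem_transcendentalPart_iff x).1 hx c hc

/-- **For a surface `S` and a Fujiki form `b_S` with `n = 1` (`a ∪ a = (c · b_S(a,a)) · P`, `c ≠ 0`,
`P ≠ 0`, i.e. `b_S` = the intersection form up to `ℂˣ` read against `P`), the `b_S`-transcendental part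
IS the tree's cup-orthogonal `Surfaces.transcendentalSubspace S`.**  Proof: polarization of Fujiki's
relation using bilinearity and graded commutativity of `∪` in degree `2` (`cupProduct_gradedComm_holds`)
gives `u ∪ v = (c · b_S(u,v)) · P` for all `u, v`, and `(c · t) · P = 0 ↔ t = 0`. [cite: Huybrechts1999, §1.11 (Fujiki relation, here n = 1)]
[cite: Floccari2026, Rem. 3.4 (the transcendental lattice of a K3 surface)] -/
theorem transcendentalPart_eq_transcendentalSubspace {S : Motives.SchemeOver ℂ}
    {bS : complexBetti S 2 →ₗ[ℂ] complexBetti S 2 →ₗ[ℂ] ℂ} (hb : IsFujikiForm 1 S bS) :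
    transcendentalPart S bS = Surfaces.transcendentalSubspace S := by
  obtain ⟨hsymm, c, P, hc, hP, hrel⟩ := hb
  -- Fujiki's relation in the spelling `H² × H² → H⁴` of `transcendentalSubspace`
  have hsq : ∀ a : complexBetti S 2,
      cupProduct (rfl : 2 * 1 + 2 * 1 = 2 * 2) a a = (c * bS a a) • P := by
    intro a
    have h1 := hrel a
    change cupPowTwo a 2 = _ at h1
    rw [cupPowTwo_two, pow_one] at h1
    exact h1
  -- graded commutativity in degree `2`
  have hcomm : ∀ u v : complexBetti S 2,
      cupProduct (rfl : 2 * 1 + 2 * 1 = 2 * 2) v u = cupProduct (rfl : 2 * 1 + 2 * 1 = 2 * 2) u v := by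
    intro u v
    rw [cupProduct_gradedComm_holds ℂ (Motives.ComplexPoints S) (rfl : 2 * 1 + 2 * 1 = 2 * 2)
      (rfl : 2 * 1 + 2 * 1 = 2 * 2) v u]
    norm_num
  -- polarization: `u ∪ v = (c · b_S(u,v)) · P`
  have key : ∀ u v : complexBetti S 2,
      cupProduct (rfl : 2 * 1 + 2 * 1 = 2 * 2) u v = (c * bS u v) • P := by
    intro u v
    have e1 : cupProduct (rfl : 2 * 1 + 2 * 1 = 2 * 2) (u + v) (u + v) =
        cupProduct (rfl : 2 * 1 + 2 * 1 = 2 * 2) u u + (2 : ℂ) • cupProduct (rfl : 2 * 1 + 2 * 1 = 2 * 2) u v +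
          cupProduct (rfl : 2 * 1 + 2 * 1 = 2 * 2) v v := by
      rw [LinearMap.map_add₂, map_add, map_add, hcomm u v, two_smul]
      abel
    have e2 : bS (u + v) (u + v) = bS u u + 2 * bS u v + bS v v := by
      rw [LinearMap.map_add₂, map_add, map_add, hsymm v u]
      ring
    have e3 : (2 : ℂ) • cupProduct (rfl : 2 * 1 + 2 * 1 = 2 * 2) u v = (2 * (c * bS u v)) • P := by
      have h := hsq (u + v)
      rw [e1, hsq u, hsq v, e2] at h
      -- h : (c * bS u u) • P + 2 • (u ∪ v) + (c * bS v v) • P = (c * (bS u u + 2 * bS u v + bS v v)) • P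
      have h' : (2 : ℂ) • cupProduct (rfl : 2 * 1 + 2 * 1 = 2 * 2) u v =
          (c * (bS u u + 2 * bS u v + bS v v)) • P - (c * bS u u) • P - (c * bS v v) • P := by
        rw [← h]; abel
      rw [h', ← sub_smul, ← sub_smul]
      congr 1
      ring
    have h2 : (2 : ℂ) ≠ 0 := two_ne_zero
    calc cupProduct (rfl : 2 * 1 + 2 * 1 = 2 * 2) u v
        = (2 : ℂ)⁻¹ • ((2 : ℂ) • cupProduct (rfl : 2 * 1 + 2 * 1 = 2 * 2) u v) := by
          rw [smul_smul, inv_mul_cancel₀ h2, one_smul]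
      _ = (2 : ℂ)⁻¹ • ((2 * (c * bS u v)) • P) := by rw [e3]
      _ = (c * bS u v) • P := by
          rw [smul_smul]
          congr 1
          field_simp
  ext x
  rw [mem_transcendentalPart_iff, Surfaces.mem_transcendentalSubspace_iff]
  refine forall₂_congr fun u hu ↦ ?_
  rw [key u x, smul_eq_zero, mul_eq_zero]
  constructor
  · intro h
    exact Or.inl (Or.inr h)
  · rintro ((h | h) | h)
    · exact absurd h hc
    · exact h
    · exact absurd h hP

/-! ### The named fact -/

/-- **Floccari 2026, Theorems 1.1 and 1.2 (= Thms. 5.9–5.10; `n = 3`: Floccari 2024, Introduction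
Thms. 1–3 with Cor. 33) — the K3 surface associated with a projective `Kumⁿ`-type variety.**  For every
smooth projective complex `K` of `Kumⁿ`-type, `n ≥ 2`, and every Fujiki form `b` on `H²(K(ℂ); ℂ)` (the
Beauville–Bogomolov form up to scalar), THERE IS a complex projective K3 surface `S` (print: `S = S_K`,
"the K3 surface with transcendental lattice `H²_tr(S_K,ℤ) ⥲ H²_tr(K,ℤ)(2)`") together with a
`ℂ`-linear `γ : H²(S(ℂ); ℂ) → H²(K(ℂ); ℂ)` INDUCED BY AN ALGEBRAIC CYCLE on `K × S` ("There exists an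
algebraic cycle on `S_K × K` inducing a Hodge isometry `H²_tr(S_K,ℚ) ⥲ H²_tr(K,ℚ)(2)`") which maps
rational classes to rational classes and `(i,j)`-classes to `(i,j)`-classes, restricts to a bijection
`NS(S)^⊥ ⊗ ℂ → NS(K)^{⊥_b} ⊗ ℂ` of the transcendental parts, and is isometric there for some Fujiki form
`b_S` of the surface (the intersection form up to scalar; the printed multiplier `2` is not recorded,
module docstring), AND such that the Kuga–Satake correspondence of `S` is algebraic
(`HodgeTheory.IsKSCorrespondenceAlgebraicBetti`, Thm. 1.2 (i)) and every cartesian power `Sᵏ` satisfies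
the tree's per-variety Hodge statement in dimension `k * 2` (the body's last clause, spelled as
in `Surfaces.Floccari2026_hodgeClasses_algebraic_powers_of_K3_of_transcendental_embedding`; Thm. 1.2
(ii): "the Hodge [statement] holds for any power of `S_K`").  A THEOREM in print (status: proved; REFEREED: Geom. Topol.
2026, `n = 3` Compos. Math. 2024; unproved in the tree; printed proof: the `K3^[m]`-type subvariety
`W_K ⊂ K`, moduli of sheaves on `S_K`, Buskin–Huybrechts, Voisin 2022, Varesco 2023).
[cite: Floccari2026, Thm. 1.1 and Thm. 1.2 (§1) = Thm. 5.9 and Thm. 5.10 (§5.4)]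
[cite: Floccari2024, Introduction Thms. 1–2, proof of the §5.1 Theorem (= Thm. 3) and Cor. 33 (arXiv numbering), the case n = 3]
[cite: FloccariVaresco2024, §1 (the "suggestive expectation", resolved)] -/
def Floccari2026_associatedK3Surface_kummerType : Prop :=
  ∀ (n : ℕ), 2 ≤ n → ∀ ⦃K : Motives.SchemeOver ℂ⦄, Motives.IsSmoothProjective (2 * n) K →
    IsOfGeneralizedKummerType n K →
    ∀ (b : complexBetti K 2 →ₗ[ℂ] complexBetti K 2 →ₗ[ℂ] ℂ), IsFujikiForm n K b →
      ∃ (S : Motives.SchemeOver ℂ) (hS : Surfaces.IsK3Surface S)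
        (bS : complexBetti S 2 →ₗ[ℂ] complexBetti S 2 →ₗ[ℂ] ℂ)
        (γ : complexBetti S 2 →ₗ[ℂ] complexBetti K 2),
        IsFujikiForm 1 S bS ∧
        IsAlgebraicCorrespondence (2 * n) 2 K S γ ∧
        (∀ x : complexBetti S 2, IsRationalClass x → IsRationalClass (γ x)) ∧
        (∀ (i j : ℕ) (x : complexBetti S 2), IsOfHodgeType 2 S 2 i j x → IsOfHodgeType (2 * n) K 2 i j (γ x)) ∧
        Set.BijOn γ (Surfaces.transcendentalSubspace S) (transcendentalPart K b) ∧
        (∀ x ∈ Surfaces.transcendentalSubspace S, ∀ y ∈ Surfaces.transcendentalSubspace S,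
            b (γ x) (γ y) = bS x y) ∧
        IsKSCorrespondenceAlgebraicBetti hS.isSmoothProjective ∧
        ∀ k : ℕ, HodgeConjectureFor (k * 2) (Motives.SchemeOver.pow S k)

namespace Floccari2026_associatedK3Surface_kummerType

/-- **Theorem 1.2 by itself (forgetting the cycle): every projective `Kumⁿ`-type variety carrying a
Fujiki form has an associated projective K3 surface whose Kuga–Satake correspondence is algebraic and all
of whose powers satisfy the Hodge statement.** [cite: Floccari2026, Thm. 1.2 (i)–(ii) = Thm. 5.10] -/
theorem exists_K3_kugaSatake_powers (h : Floccari2026_associatedK3Surface_kummerType) {n : ℕ}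
    (hn : 2 ≤ n) {K : Motives.SchemeOver ℂ} (hK : Motives.IsSmoothProjective (2 * n) K)
    (hKum : IsOfGeneralizedKummerType n K)
    {b : complexBetti K 2 →ₗ[ℂ] complexBetti K 2 →ₗ[ℂ] ℂ} (hb : IsFujikiForm n K b) :
    ∃ (S : Motives.SchemeOver ℂ) (hS : Surfaces.IsK3Surface S),
      IsKSCorrespondenceAlgebraicBetti hS.isSmoothProjective ∧
        ∀ k : ℕ, HodgeConjectureFor (k * 2) (Motives.SchemeOver.pow S k) := by
  obtain ⟨S, hS, -, -, -, -, -, -, -, -, hKS, hpow⟩ := h n hn hK hKum b hb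
  exact ⟨S, hS, hKS, hpow⟩

/-- **The `Kum³` spelling = Floccari 2024, Introduction Thms. 1–3 with Cor. 33 for the associated K3
surface of a projective hyperkähler SIXFOLD of generalized Kummer type, by name** (there `S_K` comes from
the `K3^[3]`-type resolution `Y_K → K/G`, `G ≅ (ℤ/2)⁵`). [cite: Floccari2024, Introduction Thms. 1–3 and Cor. 33 (arXiv numbering)]
[cite: Floccari2026, Thms. 1.1–1.2] -/
theorem kum3Type (h : Floccari2026_associatedK3Surface_kummerType) {K : Motives.SchemeOver ℂ}
    (hK : Motives.IsSmoothProjective 6 K) (hKum : IsOfGeneralizedKummerType 3 K)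
    {b : complexBetti K 2 →ₗ[ℂ] complexBetti K 2 →ₗ[ℂ] ℂ} (hb : IsFujikiForm 3 K b) :
    ∃ (S : Motives.SchemeOver ℂ) (hS : Surfaces.IsK3Surface S)
      (bS : complexBetti S 2 →ₗ[ℂ] complexBetti S 2 →ₗ[ℂ] ℂ)
      (γ : complexBetti S 2 →ₗ[ℂ] complexBetti K 2),
      IsFujikiForm 1 S bS ∧
      IsAlgebraicCorrespondence 6 2 K S γ ∧
      (∀ x : complexBetti S 2, IsRationalClass x → IsRationalClass (γ x)) ∧
      (∀ (i j : ℕ) (x : complexBetti S 2), IsOfHodgeType 2 S 2 i j x → IsOfHodgeType 6 K 2 i j (γ x)) ∧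
      Set.BijOn γ (Surfaces.transcendentalSubspace S) (transcendentalPart K b) ∧
      (∀ x ∈ Surfaces.transcendentalSubspace S, ∀ y ∈ Surfaces.transcendentalSubspace S,
          b (γ x) (γ y) = bS x y) ∧
      IsKSCorrespondenceAlgebraicBetti hS.isSmoothProjective ∧
      ∀ k : ℕ, HodgeConjectureFor (k * 2) (Motives.SchemeOver.pow S k) :=
  h 3 (by norm_num) hK hKum b hb

/-- The `Kum⁴` spelling (dimension `8`; rung H3 / cell `hodge-kum4`): the associated K3 surface of a
projective `Kum⁴`-type variety, with the algebraic transcendental similitude, the Kuga–Satake property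
and the powers property. [cite: Floccari2026, Thms. 1.1–1.2] -/
theorem kum4Type (h : Floccari2026_associatedK3Surface_kummerType) {K : Motives.SchemeOver ℂ}
    (hK : Motives.IsSmoothProjective 8 K) (hKum : IsOfGeneralizedKummerType 4 K)
    {b : complexBetti K 2 →ₗ[ℂ] complexBetti K 2 →ₗ[ℂ] ℂ} (hb : IsFujikiForm 4 K b) :
    ∃ (S : Motives.SchemeOver ℂ) (hS : Surfaces.IsK3Surface S)
      (bS : complexBetti S 2 →ₗ[ℂ] complexBetti S 2 →ₗ[ℂ] ℂ)
      (γ : complexBetti S 2 →ₗ[ℂ] complexBetti K 2),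
      IsFujikiForm 1 S bS ∧
      IsAlgebraicCorrespondence 8 2 K S γ ∧
      (∀ x : complexBetti S 2, IsRationalClass x → IsRationalClass (γ x)) ∧
      (∀ (i j : ℕ) (x : complexBetti S 2), IsOfHodgeType 2 S 2 i j x → IsOfHodgeType 8 K 2 i j (γ x)) ∧
      Set.BijOn γ (Surfaces.transcendentalSubspace S) (transcendentalPart K b) ∧
      (∀ x ∈ Surfaces.transcendentalSubspace S, ∀ y ∈ Surfaces.transcendentalSubspace S,
          b (γ x) (γ y) = bS x y) ∧
      IsKSCorrespondenceAlgebraicBetti hS.isSmoothProjective ∧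
      ∀ k : ℕ, HodgeConjectureFor (k * 2) (Motives.SchemeOver.pow S k) :=
  h 4 (by norm_num) hK hKum b hb

/-- With the surface-side Fujiki form, the image of the transcendental part can be read in the new notion
on both sides: `γ` is a bijection `transcendentalPart S b_S → transcendentalPart K b`.
[cite: Floccari2026, Thm. 1.1] -/
theorem bijOn_transcendentalPart {K S : Motives.SchemeOver ℂ}
    {b : complexBetti K 2 →ₗ[ℂ] complexBetti K 2 →ₗ[ℂ] ℂ}
    {bS : complexBetti S 2 →ₗ[ℂ] complexBetti S 2 →ₗ[ℂ] ℂ} (hbS : IsFujikiForm 1 S bS)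
    {γ : complexBetti S 2 →ₗ[ℂ] complexBetti K 2}
    (hγ : Set.BijOn γ (Surfaces.transcendentalSubspace S) (transcendentalPart K b)) :
    Set.BijOn γ (transcendentalPart S bS) (transcendentalPart K b) := by
  rwa [transcendentalPart_eq_transcendentalSubspace hbS]

end Floccari2026_associatedK3Surface_kummerType

end Literature.AlgebraicGeometry.Hyperkaehler

end
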